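import Summits.CriticalPhenomena.PercolationContinuityZ3.Theorems.Transplant.StatementBoxProdZ2
import Summits.CriticalPhenomena.PercolationContinuityZ3.Theorems.TransplantHeisenbergZ2
import Summits.CriticalPhenomena.PercolationContinuityZ3.Theorems.TransplantHeisenbergAmenable
import Literature.Barriers.CriticalPhenomena.SubexponentialGrowthZdBurtonKeane
import HarnessLib

/-!
# `X □ ℤ^d` has subexponential growth, is amenable, and has a unique infinite cluster whenever `X` is
# quasi-transitive of subexponential growth — hypothesis U of rung R2c for every such `X` (e.g. `H₃(ℤ)`)

Builds on p205010 (kernel theorem, internal audit signed; external expert review pending).  Lane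
`prim-bschramm`, BLUEPRINT-I-PHI §6 Target 1 (`samePWitness_boxProdZ2` takes "uniqueness of the infinite cluster
in `X □ zdGraph 2` at `p`" as a hypothesis) and memo `P3-NILPOTENT.md` §10.2 ("second check, hypothesis U").
Proof-only helper; complements `Transplant/StatementBoxProdZ2.lean` (non-amenable `X`: exponential growth passes
to the product and Hutchcroft applies) with the AMENABLE side.

* `graphBall_boxProd_subset` — `B_{G □ H}((a,b),n) ⊆ B_G(a,n) × B_H(b,n)` (project walks: Mathlib
  `Walk.ofBoxProdLeft/Right`, `Walk.length_boxProd`), hence `ballVolume_boxProd_le`;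
* `not_hasExponentialGrowth_boxProd_zdGraph` — subexponential growth of `X` passes to `X □ ℤ^d`
  (`|B| ≤ |B_X| (2n+1)^d`, tree `ballVolume_zdGraph_le`);
* `isGraphAmenable_boxProd_zdGraph` — by the tree's contrapositive `hasExponentialGrowth_of_not_isGraphAmenable`
  and `isQuasiTransitive_boxProd_zdGraph`;
* `numInfiniteClusters_le_one_boxProd_zdGraph` — Burton–Keane (`BurtonKeane1989_atMostOneInfiniteCluster_holds`)
  for every `p`;
* instances for `X = Cay(H₃(ℤ))`: `hz2_amenable`, `hz2_numInfiniteClusters_le_one` (with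
  `not_hasExponentialGrowth_heis`, p208448).
[cite: LyonsPeres2016, §6.1 (p. 279)] [cite: BurtonKeane1989]
-/

noncomputable section

namespace Summit.CriticalPhenomena.PercolationContinuityZ3.Theorems.Transplant

open MeasureTheory Filter Literature.Probability.Percolation Literature.Probability.LatticeModels
open Literature.Barriers.CriticalPhenomena (IsQuasiTransitive IsGraphAmenable HasExponentialGrowth graphBall ballVolume
  hasExponentialGrowth_of_not_isGraphAmenable ballVolume_zdGraph_le BurtonKeane1989_atMostOneInfiniteCluster_holds)

/-- **Balls of a product lie in the product of balls**: a walk of length `≤ n` in `G □ H` projects to walks of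
length `≤ n` in each factor. [folklore] -/
theorem graphBall_boxProd_subset {α β : Type*} [DecidableEq α] [DecidableEq β] (G : SimpleGraph α) (H : SimpleGraph β)
    [DecidableRel G.Adj] [DecidableRel H.Adj] (a : α) (b : β) (n : ℕ) :
    graphBall (G □ H) (a, b) n ⊆ graphBall G a n ×ˢ graphBall H b n := by
  rintro ⟨x, y⟩ ⟨w, hw⟩
  have hl := w.length_boxProd
  refine ⟨⟨w.ofBoxProdLeft, ?_⟩, ⟨w.ofBoxProdRight, ?_⟩⟩
  · change w.ofBoxProdLeft.length ≤ n
    omega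
  · change w.ofBoxProdRight.length ≤ n
    omega

/-- `|B_{G □ H}((a,b),n)| ≤ |B_G(a,n)| · |B_H(b,n)|` (locally finite factors). [folklore] -/
theorem ballVolume_boxProd_le {α β : Type*} (G : SimpleGraph α) (H : SimpleGraph β) [G.LocallyFinite]
    [H.LocallyFinite] (a : α) (b : β) (n : ℕ) :
    ballVolume (G □ H) (a, b) n ≤ ballVolume G a n * ballVolume H b n := by
  classical
  unfold ballVolume
  rw [← Set.ncard_prod]
  exact Set.ncard_le_ncard (graphBall_boxProd_subset G H a b n)
    ((Literature.Barriers.CriticalPhenomena.graphBall_finite G a n).prod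
      (Literature.Barriers.CriticalPhenomena.graphBall_finite H b n))

/-- **Subexponential growth passes to `X □ ℤ^d`**: if `X` does NOT have exponential growth (tree predicate,
at some vertex `w`: for every `c > 1`, `|B_X(w,n)| < cⁿ` for infinitely many `n`), then neither has `X □ ℤ^d`.
[cite: LyonsPeres2016, §6.1] -/
theorem not_hasExponentialGrowth_boxProd_zdGraph {W : Type} (X : SimpleGraph W) [X.LocallyFinite] (d : ℕ)
    (hX : ¬ HasExponentialGrowth X) : ¬ HasExponentialGrowth (X □ zdGraph d) := by
  intro h
  apply hX
  intro w
  obtain ⟨c, hc, hev⟩ := h (w, 0)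
  -- use the rate `√c` for `X`
  have hsc : 1 < Real.sqrt c := by
    rw [show (1 : ℝ) = Real.sqrt 1 by simp]
    exact Real.sqrt_lt_sqrt (by norm_num) hc
  refine ⟨Real.sqrt c, hsc, ?_⟩
  -- eventually `(2n+1)^d ≤ (√c)^n`
  have hpoly : ∀ᶠ n : ℕ in atTop, ((2 * n + 1 : ℕ) : ℝ) ^ d ≤ Real.sqrt c ^ n := by
    have hlim := (tendsto_pow_const_div_const_pow_of_one_lt d hsc).const_mul ((3 : ℝ) ^ d)
    rw [mul_zero] at hlim
    filter_upwards [hlim.eventually (gt_mem_nhds zero_lt_one), eventually_ge_atTop 1] with n hn hn1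
    have hcn : (0 : ℝ) < Real.sqrt c ^ n := pow_pos (by linarith) n
    rw [← mul_div_assoc, div_lt_one hcn] at hn
    have h3 : ((2 * n + 1 : ℕ) : ℝ) ^ d ≤ (3 : ℝ) ^ d * (n : ℝ) ^ d := by
      rw [← mul_pow]
      apply pow_le_pow_left₀ (by positivity)
      have : (1 : ℝ) ≤ n := by exact_mod_cast hn1
      push_cast; linarith
    linarith
  filter_upwards [hev, hpoly] with n hn hp
  -- `c^n ≤ |B_prod| ≤ |B_X| (2n+1)^d ≤ |B_X| (√c)^n`, and `c^n = (√c)^n (√c)^n`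
  have hvol : (ballVolume (X □ zdGraph d) (w, 0) n : ℝ) ≤ ballVolume X w n * ((2 * n + 1 : ℕ) : ℝ) ^ d := by
    have h1 := ballVolume_boxProd_le X (zdGraph d) w 0 n
    have h2 := ballVolume_zdGraph_le d n
    calc (ballVolume (X □ zdGraph d) (w, 0) n : ℝ) ≤ (ballVolume X w n * ballVolume (zdGraph d) 0 n : ℕ) := by
          exact_mod_cast h1
      _ ≤ ballVolume X w n * ((2 * n + 1 : ℕ) : ℝ) ^ d := by
          push_cast
          exact mul_le_mul_of_nonneg_left (by exact_mod_cast h2) (by positivity)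
  have hsq : c ^ n = Real.sqrt c ^ n * Real.sqrt c ^ n := by
    rw [← mul_pow, Real.mul_self_sqrt (by linarith)]
  have hpos : (0 : ℝ) < Real.sqrt c ^ n := pow_pos (by linarith) n
  by_contra hlt
  push Not at hlt
  -- `|B_X| < (√c)^n` would give `|B_prod| < c^n`
  have : (ballVolume (X □ zdGraph d) (w, 0) n : ℝ) < c ^ n := by
    calc (ballVolume (X □ zdGraph d) (w, 0) n : ℝ) ≤ ballVolume X w n * ((2 * n + 1 : ℕ) : ℝ) ^ d := hvol
      _ ≤ ballVolume X w n * Real.sqrt c ^ n := mul_le_mul_of_nonneg_left hp (by positivity)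
      _ < Real.sqrt c ^ n * Real.sqrt c ^ n := mul_lt_mul_of_pos_right hlt hpos
      _ = c ^ n := hsq.symm
  linarith

/-- **`X □ ℤ^d` is amenable** for quasi-transitive `X` of subexponential growth (Lyons–Peres §6.1: a
nonamenable quasi-transitive graph grows exponentially; tree `hasExponentialGrowth_of_not_isGraphAmenable`).
[cite: LyonsPeres2016, §6.1 (p. 279)] -/
theorem isGraphAmenable_boxProd_zdGraph {W : Type} [DecidableEq W] (X : SimpleGraph W) [X.LocallyFinite]
    (hq : IsQuasiTransitive X) (hX : ¬ HasExponentialGrowth X) (d : ℕ) :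
    IsGraphAmenable (X □ zdGraph d) := by
  by_contra h
  exact not_hasExponentialGrowth_boxProd_zdGraph X d hX
    (hasExponentialGrowth_of_not_isGraphAmenable (X □ zdGraph d) (isQuasiTransitive_boxProd_zdGraph hq d) h)

/-- **Uniqueness of the infinite cluster on `X □ ℤ^d`** (Burton–Keane on amenable quasi-transitive graphs,
tree `BurtonKeane1989_atMostOneInfiniteCluster_holds`), for connected quasi-transitive `X` of subexponential growth
and every `p` — hypothesis U of `samePWitness_boxProdZ2`. [cite: BurtonKeane1989] [cite: LyonsPeres2016, Thm. 7.6] -/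
theorem numInfiniteClusters_le_one_boxProd_zdGraph {W : Type} [DecidableEq W] (X : SimpleGraph W) [X.LocallyFinite]
    (hc : X.Connected) (hq : IsQuasiTransitive X) (hX : ¬ HasExponentialGrowth X) (d : ℕ) (p : unitInterval) :
    ∀ᵐ ω ∂(bondPercolation (X □ zdGraph d) p), numInfiniteClusters ω ≤ 1 :=
  BurtonKeane1989_atMostOneInfiniteCluster_holds (X □ zdGraph d) (connected_boxProd_zdGraph hc d)
    (isQuasiTransitive_boxProd_zdGraph hq d) (isGraphAmenable_boxProd_zdGraph X hq hX d) p

/-! ## Instances: `Cay(H₃(ℤ)) □ ℤ²` -/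

open Summit.CriticalPhenomena.PercolationContinuityZ3.Theorems.Heisenberg
  (heisenbergGraph heisenbergGraph_quasiTransitive heisenbergGraph_connected not_hasExponentialGrowth_heis)
open Summit.CriticalPhenomena.PercolationContinuityZ3.Theorems.HeisenbergZ2 (heisenbergZ2Graph)

/-- `Cay(H₃(ℤ)) □ ℤ²` is amenable. [cite: LyonsPeres2016, §6.1 (p. 279)] -/
theorem hz2_amenable : IsGraphAmenable heisenbergZ2Graph :=
  isGraphAmenable_boxProd_zdGraph heisenbergGraph heisenbergGraph_quasiTransitive not_hasExponentialGrowth_heis 2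

/-- Uniqueness of the infinite cluster on `Cay(H₃(ℤ)) □ ℤ²` for every `p` (hypothesis U of rung R2c for
`X = H₃`). [cite: BurtonKeane1989] -/
theorem hz2_numInfiniteClusters_le_one (p : unitInterval) :
    ∀ᵐ ω ∂(bondPercolation heisenbergZ2Graph p), numInfiniteClusters ω ≤ 1 :=
  numInfiniteClusters_le_one_boxProd_zdGraph heisenbergGraph heisenbergGraph_connected
    heisenbergGraph_quasiTransitive not_hasExponentialGrowth_heis 2 p

end Summit.CriticalPhenomena.PercolationContinuityZ3.Theorems.Transplant
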